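import Literature.RepresentationTheory.Semisimple.CharpolySubquotient
import Mathlib.RepresentationTheory.AlgebraRepresentation.Basic
import HarnessLib

/-!
# Isotypic projections realised by algebra elements (Jacobson density)

Topic `Literature/RepresentationTheory/Semisimple`.  The module-theoretic engine of the
Brauer–Nesbitt theorem in arbitrary characteristic (Bourbaki, *Algèbre* VIII, § 20 n° 6, Thm. 2,
Cor. 1, p. 378; file `BrauerNesbitt`): Bourbaki's proof rests on the linear independence of the
characters of the simple modules (Prop. 6, p. 375), itself "d'après le cor. 1 de la prop. 4
(VIII, p. 79)" — Jacobson density: for finitely many pairwise non-isomorphic simple modules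
`S, T₁, …` there is `b ∈ A` with `b_S = a_S` and `b_{T_i} = 0` — together with Schur's lemma
over an algebraically closed field.  We record the density statement in the concrete form the
induction needs (`k` any field, `R` a `k`-algebra, `M`, `N` semisimple `R`-modules of finite
dimension over `k`, `S ⊆ M` simple with `Hom_R(S, N) = 0`), all **proved**:

* `Module.exists_smul_isotypicProjection`: there is `r ∈ R` killing `N`, fixing the isotypic
  component `M_S` of type `S` pointwise and killing the other isotypic components of `M`
  (density in `M × N`, as in the accepted characteristic-zero file `EquivOfCharacter`);
* `Module.trace_smul_mul_eq_trace_isotypicComponent`: for such `r`, `Tr_M(t r) = Tr_{M_S}(t)`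
  for every `t ∈ R`;
* `Module.exists_trace_smul_eq_one`: over an algebraically closed `k`, a simple `R`-module of
  finite dimension carries some `t ∈ R` of trace `1` (Schur: `End_R(S) = k`, Mathlib
  `IsSimpleModule.algebraMap_end_bijective_of_isAlgClosed`, and density for `S`) — Bourbaki's
  Prop. 5, (ii) ⇒ (i), in the split case `D = K`;
* `Module.forall_linearMap_eq_zero_symm`: `Hom_R(S, N) = 0` for all simple `S ⊆ M` iff
  `Hom_R(T, M) = 0` for all simple `T ⊆ N`;
* `Module.nonempty_linearEquiv_of_cancel_simple`: the cancellation step of the induction — a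
  common simple constituent can be split off, the characteristic polynomials of the
  complements still agree on the generating set `𝒜` (`K[X]` is a domain), and an isomorphism
  of the complements gives one of `M` and `N`.

## References

* N. Bourbaki, *Algèbre, Chapitre VIII*, 2ᵉ éd., Springer (2012), § 4 n° 2 (densité), § 20
  n° 6, Prop. 5, Prop. 6, Thm. 2, Cor. 1 (pp. 374–378). [BourbakiAlgebreVIII2012]
-/

noncomputable section

open Module Polynomial

namespace Literature.RepresentationTheory.Semisimple

universe u v w w'

variable {k : Type u} [Field k] {R : Type v} [Ring R] [Algebra k R]
  {M : Type w} [AddCommGroup M] [Module k M] [Module R M] [IsScalarTower k R M]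
  [FiniteDimensional k M]
  {N : Type w'} [AddCommGroup N] [Module k N] [Module R N] [IsScalarTower k R N]
  [FiniteDimensional k N]

/-! ### An algebra element acting as an isotypic projection -/

/-- **Isotypic projections come from the algebra.**  Let `M`, `N` be semisimple `R`-modules of
finite dimension over `k` and `S ⊆ M` a simple submodule with `Hom_R(S, N) = 0`.  Then some
`r ∈ R` acts as `0` on `N`, as the identity on the isotypic component `M_S` of type `S`, and as
`0` on every other isotypic component of `M`.  (In the semisimple module `M × N` the isotypic
component of type `S × 0` and the sum of the other isotypic components are fully invariant
complements, so the projection onto the former lies in the bicommutant and is the action of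
some `r ∈ R` by the Jacobson density theorem, Mathlib
`Module.Finite.toModuleEnd_moduleEnd_surjective`; Bourbaki's "cor. 1 de la prop. 4 (VIII,
p. 79)" invoked in the proof of Prop. 6.)
[cite: BourbakiAlgebreVIII2012, VIII § 20 n° 6, Prop. 6 (p. 375)] -/
theorem Module.exists_smul_isotypicProjection (k : Type u) [Field k] [Algebra k R] [Module k M]
    [IsScalarTower k R M] [FiniteDimensional k M] [Module k N] [IsScalarTower k R N]
    [FiniteDimensional k N] [IsSemisimpleModule R M] [IsSemisimpleModule R N]
    (S : Submodule R M) [IsSimpleModule R S] (hSN : ∀ f : S →ₗ[R] N, f = 0) :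
    ∃ r : R, (∀ y : N, r • y = 0) ∧ (∀ x ∈ isotypicComponent R M S, r • x = x) ∧
      ∀ c ∈ isotypicComponents R M, c ≠ isotypicComponent R M S → ∀ x ∈ c, r • x = 0 := by
  classical
  haveI : Nontrivial S := IsSimpleModule.nontrivial R S
  -- `M × N` is semisimple (Mathlib has the `Π`-instance only; the binary product is the
  -- tree's `Literature.AlgebraicGeometry.Motives.isSemisimpleModule_prod`, repeated inline
  -- rather than importing the motives layer)
  haveI : IsSemisimpleModule R (M × N) := by
    have h1 : IsSemisimpleModule R (LinearMap.range (LinearMap.inl R M N)) :=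
      .of_surjective _ (LinearMap.inl R M N).surjective_rangeRestrict
    have h2 : IsSemisimpleModule R (LinearMap.range (LinearMap.inr R M N)) :=
      .of_surjective _ (LinearMap.inr R M N).surjective_rangeRestrict
    have h := IsSemisimpleModule.sup h1 h2
    rw [LinearMap.sup_range_inl_inr] at h
    exact .congr (Submodule.topEquiv).symm
  -- the copy `S'` of `S` inside `M × N`
  let S' : Submodule R (M × N) := S.map (LinearMap.inl R M N)
  let eS : S ≃ₗ[R] S' := Submodule.equivMapOfInjective _ LinearMap.inl_injective S
  haveI : IsSimpleModule R S' := IsSimpleModule.congr eS.symm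
  -- the isotypic component `A` of type `S` and its fully invariant complement `B`
  set A : Submodule R (M × N) := isotypicComponent R (M × N) S' with hA
  have hAmem : A ∈ isotypicComponents R (M × N) := ⟨S', inferInstance, rfl⟩
  set B : Submodule R (M × N) := sSup (isotypicComponents R (M × N) \ {A}) with hB
  have hAB : IsCompl A B := by
    refine ⟨sSupIndep_isotypicComponents (R := R) (M := M × N) hAmem, ?_⟩
    rw [codisjoint_iff, eq_top_iff, ← sSup_isotypicComponents (R := R) (M := M × N)]
    refine sSup_le fun c hc ↦ ?_
    by_cases hcA : c = A
    · exact hcA ▸ le_sup_left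
    · exact (le_sSup (s := isotypicComponents R (M × N) \ {A}) ⟨hc, hcA⟩).trans le_sup_right
  have hAinv : A.IsFullyInvariant := Submodule.IsFullyInvariant.of_mem_isotypicComponents hAmem
  have hBinv : B.IsFullyInvariant := Submodule.isFullyInvariant_sSup fun c hc ↦
    Submodule.IsFullyInvariant.of_mem_isotypicComponents hc.1
  -- the projection onto `A` along `B`
  let p : (M × N) →ₗ[R] (M × N) := A.projection B hAB
  have hpA : ∀ x ∈ A, p x = x := fun x hx ↦ Submodule.projection_apply_of_mem_left hAB hx
  have hpB : ∀ x ∈ B, p x = 0 := fun x hx ↦ Submodule.projection_apply_of_mem_right hAB hx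
  have hpmem : ∀ x, p x ∈ A := fun x ↦ Submodule.projection_apply_mem hAB x
  -- `p` commutes with every `R`-endomorphism (both `A` and `B` are fully invariant)
  have hcomm : ∀ (f : Module.End R (M × N)) (x : M × N), f (p x) = p (f x) := by
    intro f x
    have hx : x ∈ A ⊔ B := hAB.sup_eq_top.symm ▸ Submodule.mem_top
    obtain ⟨a, ha, b, hb, rfl⟩ := Submodule.mem_sup.1 hx
    have ha' : f a ∈ A := hAinv f ha
    have hb' : f b ∈ B := hBinv f hb
    calc f (p (a + b)) = f a := by rw [map_add p, hpA a ha, hpB b hb, add_zero]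
      _ = p (f (a + b)) := by rw [map_add f, map_add p, hpA (f a) ha', hpB (f b) hb', add_zero]
  -- Jacobson density: `p` is the action of some `r ∈ R`
  haveI : Module.Finite (Module.End R (M × N)) (M × N) :=
    Module.Finite.of_restrictScalars_finite k _ _
  let pE : (M × N) →ₗ[Module.End R (M × N)] (M × N) :=
    { toFun := p, map_add' := map_add p, map_smul' := fun f x ↦ (hcomm f x).symm }
  obtain ⟨r, hr⟩ := Module.Finite.toModuleEnd_moduleEnd_surjective (R := R) (M := M × N) pE
  have hr' : ∀ x : M × N, r • x = p x := fun x ↦ congr($hr x)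
  -- `A` does not meet `0 × N`: otherwise a simple piece of the intersection gives `S → N`
  have hAN : A.comap (LinearMap.inr R M N) = ⊥ := by
    rcases IsSemisimpleModule.eq_bot_or_exists_simple_le (A.comap (LinearMap.inr R M N)) with
      h0 | ⟨T, hT, hTs⟩
    · exact h0
    · exfalso
      haveI := hTs
      have hT' : T.map (LinearMap.inr R M N) ≤ A := Submodule.map_le_iff_le_comap.2 hT
      let eT : T ≃ₗ[R] T.map (LinearMap.inr R M N) :=
        Submodule.equivMapOfInjective _ LinearMap.inr_injective T
      haveI : IsSimpleModule R (T.map (LinearMap.inr R M N)) := IsSimpleModule.congr eT.symm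
      obtain ⟨e⟩ := isIsotypicOfType_submodule_iff.mp
        (le_isotypicComponent_iff.mp (le_refl A)) _ hT'
      -- `e : T.map inr ≃ S'`; assemble an injective `R`-linear map `S → N`
      let f : S →ₗ[R] N :=
        T.subtype ∘ₗ (eT.symm.toLinearMap ∘ₗ (e.symm.toLinearMap ∘ₗ eS.toLinearMap))
      have hf : Function.Injective f :=
        T.injective_subtype.comp
          (eT.symm.injective.comp (e.symm.injective.comp eS.injective))
      obtain ⟨x, hx⟩ := exists_ne (0 : S)
      refine hx (hf ?_)
      rw [hSN f, map_zero, LinearMap.zero_apply]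
  -- (1) `r` kills `N`
  have h1 : ∀ y : N, r • y = 0 := by
    intro y
    have hmem : p (0, y) ∈ A := hpmem _
    have hy : r • ((0 : M), y) = p (0, y) := hr' _
    rw [Prod.smul_mk, smul_zero] at hy
    have h2 : r • y ∈ A.comap (LinearMap.inr R M N) := by
      change ((0 : M), r • y) ∈ A
      rw [hy]
      exact hmem
    rwa [hAN, Submodule.mem_bot] at h2
  -- an isotypic component `M_T` of `M`, `T ⊆ M` simple, sits in the one of type `T × 0`
  have hcomp : ∀ (T : Submodule R M) [IsSimpleModule R T], ∀ x ∈ isotypicComponent R M T,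
      (x, (0 : N)) ∈ isotypicComponent R (M × N) (T.map (LinearMap.inl R M N)) := by
    intro T _ x hx
    let eT : T ≃ₗ[R] T.map (LinearMap.inl R M N) :=
      Submodule.equivMapOfInjective _ LinearMap.inl_injective T
    have h := LinearMap.le_comap_isotypicComponent (S := T) (LinearMap.inl R M N) hx
    rw [Submodule.mem_comap, LinearEquiv.isotypicComponent_eq eT] at h
    exact h
  -- (2) `r` fixes the isotypic component of type `S`
  have h2 : ∀ x ∈ isotypicComponent R M S, r • x = x := by
    intro x hx
    have hxA : (x, (0 : N)) ∈ A := hcomp S x hx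
    have hx' := hr' (x, 0)
    rw [hpA _ hxA, Prod.smul_mk, smul_zero, Prod.mk.injEq] at hx'
    exact hx'.1
  -- (3) `r` kills the other isotypic components of `M`
  have h3 : ∀ c ∈ isotypicComponents R M, c ≠ isotypicComponent R M S → ∀ x ∈ c, r • x = 0 := by
    rintro c ⟨T, hT, rfl⟩ hc x hx
    haveI := hT
    let T' : Submodule R (M × N) := T.map (LinearMap.inl R M N)
    let eT : T ≃ₗ[R] T' := Submodule.equivMapOfInjective _ LinearMap.inl_injective T
    haveI : IsSimpleModule R T' := IsSimpleModule.congr eT.symm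
    have hxA' : (x, (0 : N)) ∈ isotypicComponent R (M × N) T' := hcomp T x hx
    have hmem' : isotypicComponent R (M × N) T' ∈ isotypicComponents R (M × N) :=
      ⟨T', inferInstance, rfl⟩
    have hne : isotypicComponent R (M × N) T' ≠ A := by
      intro hEq
      obtain ⟨e⟩ := isIsotypicOfType_submodule_iff.mp
        (le_isotypicComponent_iff.mp (le_refl A)) T' (hEq ▸ Submodule.le_isotypicComponent T')
      exact hc (LinearEquiv.isotypicComponent_eq (eT.trans (e.trans eS.symm)))
    have hxB : (x, (0 : N)) ∈ B :=
      (le_sSup (s := isotypicComponents R (M × N) \ {A}) ⟨hmem', hne⟩) hxA'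
    have hx' := hr' (x, 0)
    rw [hpB _ hxB, Prod.smul_mk, smul_zero, Prod.ext_iff] at hx'
    exact hx'.1
  exact ⟨r, h1, h2, h3⟩

/-- The isotypic component of type `S` and the sum of the other isotypic components are
complementary (`sSupIndep_isotypicComponents`, `sSup_isotypicComponents`). [folklore] -/
theorem Module.isCompl_isotypicComponent_sSup_diff [IsSemisimpleModule R M] (S : Submodule R M)
    [IsSimpleModule R S] :
    IsCompl (isotypicComponent R M S)
      (sSup (isotypicComponents R M \ {isotypicComponent R M S})) := by
  have hmem : isotypicComponent R M S ∈ isotypicComponents R M := ⟨S, inferInstance, rfl⟩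
  refine ⟨sSupIndep_isotypicComponents (R := R) (M := M) hmem, ?_⟩
  rw [codisjoint_iff, eq_top_iff, ← sSup_isotypicComponents (R := R) (M := M)]
  refine sSup_le fun c hc ↦ ?_
  by_cases hcA : c = isotypicComponent R M S
  · exact hcA ▸ le_sup_left
  · exact (le_sSup (s := isotypicComponents R M \ {isotypicComponent R M S}) ⟨hc, hcA⟩).trans
      le_sup_right

omit [FiniteDimensional k M] in
/-- An element killing every isotypic component other than `M_S` kills their sum.
[folklore] -/
theorem Module.smul_eq_zero_of_mem_sSup_diff (S : Submodule R M) {r : R}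
    (h : ∀ c ∈ isotypicComponents R M, c ≠ isotypicComponent R M S → ∀ x ∈ c, r • x = 0)
    {x : M} (hx : x ∈ sSup (isotypicComponents R M \ {isotypicComponent R M S})) :
    r • x = 0 := by
  rw [sSup_eq_iSup'] at hx
  induction hx using Submodule.iSup_induction' with
  | mem c y hy => exact h c.1 c.2.1 c.2.2 y hy
  | zero => exact smul_zero r
  | add y z _ _ hy hz => rw [smul_add, hy, hz, add_zero]

/-- **Traces through an isotypic projection.**  If `r ∈ R` fixes the isotypic component `M_S`
pointwise and kills the other isotypic components of the semisimple module `M`, then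
`Tr_M(t r) = Tr_{M_S}(t)` for every `t ∈ R` (additivity of the trace over `M = M_S ⊕ ⨁ M_T`).
[folklore] -/
theorem Module.trace_smul_mul_eq_trace_isotypicComponent [IsSemisimpleModule R M]
    (S : Submodule R M) [IsSimpleModule R S] {r : R}
    (hfix : ∀ x ∈ isotypicComponent R M S, r • x = x)
    (hzero : ∀ c ∈ isotypicComponents R M, c ≠ isotypicComponent R M S → ∀ x ∈ c, r • x = 0)
    (t : R) :
    LinearMap.trace k M (DistribSMul.toLinearMap k M (t * r)) =
      LinearMap.trace k (isotypicComponent R M S)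
        (DistribSMul.toLinearMap k (isotypicComponent R M S) t) := by
  set A := isotypicComponent R M S with hA
  set B := sSup (isotypicComponents R M \ {A}) with hB
  have hAB : IsCompl A B := Module.isCompl_isotypicComponent_sSup_diff (R := R) (M := M) S
  haveI := Module.finiteDimensional_submodule_tower (k := k) A
  haveI := Module.finiteDimensional_submodule_tower (k := k) B
  rw [Module.trace_smul_eq_add_of_isCompl (k := k) A B hAB (t * r)]
  have hAt : DistribSMul.toLinearMap k A (t * r) = DistribSMul.toLinearMap k A t := by
    apply LinearMap.ext
    intro x
    apply Subtype.ext
    change (t * r) • (x : M) = t • (x : M)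
    rw [mul_smul, hfix x x.2]
  have hBt : DistribSMul.toLinearMap k B (t * r) = 0 := by
    apply LinearMap.ext
    intro x
    apply Subtype.ext
    change (t * r) • (x : M) = 0
    rw [mul_smul, Module.smul_eq_zero_of_mem_sSup_diff (R := R) S hzero x.2, smul_zero]
  rw [hAt, hBt, map_zero, add_zero]

/-! ### Schur and density on a single simple module -/

/-- **A simple module over an algebraically closed field carries an element of trace one.**
For `k` algebraically closed and `S` a simple `R`-module of finite dimension over `k` there is
`t ∈ R` with `Tr_S(t) = 1`: by Schur `End_R(S) = k` (Mathlib
`IsSimpleModule.algebraMap_end_bijective_of_isAlgClosed`), so every `k`-linear endomorphism of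
`S` lies in the bicommutant and is the action of some `t ∈ R` (Jacobson density, "théorème de
Burnside"); take a projection onto a line.  This is Bourbaki's Prop. 5, (ii) ⇒ (i), loc. cit.,
in the case `D = K`. [cite: BourbakiAlgebreVIII2012, VIII § 20 n° 6, Prop. 5 (p. 374)] -/
theorem Module.exists_trace_smul_eq_one [IsAlgClosed k] (S : Type w) [AddCommGroup S]
    [Module k S] [Module R S] [IsScalarTower k R S] [FiniteDimensional k S] [IsSimpleModule R S] :
    ∃ t : R, LinearMap.trace k S (DistribSMul.toLinearMap k S t) = 1 := by
  classical
  haveI : Nontrivial S := IsSimpleModule.nontrivial R S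
  obtain ⟨v, hv⟩ := exists_ne (0 : S)
  obtain ⟨C, hLC⟩ := (k ∙ v).exists_isCompl
  let π : S →ₗ[k] S := (k ∙ v).projection C hLC
  have hπ : LinearMap.IsProj (k ∙ v) π :=
    ⟨fun x ↦ Submodule.projection_apply_mem hLC x,
      fun x hx ↦ Submodule.projection_apply_of_mem_left hLC hx⟩
  have htr : LinearMap.trace k S π = 1 := by
    rw [hπ.trace, finrank_span_singleton hv, Nat.cast_one]
  -- `π` commutes with `End_R(S) = k` (Schur), i.e. lies in the bicommutant
  have hsch := IsSimpleModule.algebraMap_end_bijective_of_isAlgClosed k (A := R) (V := S)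
  haveI : Module.Finite (Module.End R S) S := Module.Finite.of_restrictScalars_finite k _ _
  let πE : S →ₗ[Module.End R S] S :=
    { toFun := π
      map_add' := map_add π
      map_smul' := fun g x ↦ by
        obtain ⟨c, rfl⟩ := hsch.2 g
        rw [RingHom.id_apply, Module.End.smul_def, Module.End.smul_def,
          Module.algebraMap_end_apply, Module.algebraMap_end_apply, map_smul] }
  obtain ⟨t, ht⟩ := Module.Finite.toModuleEnd_moduleEnd_surjective (R := R) (M := S) πE
  refine ⟨t, ?_⟩
  have htπ : DistribSMul.toLinearMap k S t = π := LinearMap.ext fun x ↦ congr($ht x)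
  rw [htπ, htr]

/-! ### No common constituent: symmetry -/

omit [Module k M] [IsScalarTower k R M] [FiniteDimensional k M] [Module k N] [IsScalarTower k R N]
  [FiniteDimensional k N] [Algebra k R] in
/-- If no simple submodule of `M` maps non-trivially to `N`, then no simple submodule of `N`
maps non-trivially to `M` (the image of a non-zero map out of a simple module is a simple
submodule isomorphic to it). [folklore] -/
theorem Module.forall_linearMap_eq_zero_symm
    (h : ∀ (S : Submodule R M), IsSimpleModule R S → ∀ f : S →ₗ[R] N, f = 0)
    (T : Submodule R N) [IsSimpleModule R T] (f : T →ₗ[R] M) : f = 0 := by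
  by_contra hf
  have hinj : Function.Injective f := (LinearMap.injective_or_eq_zero f).resolve_right hf
  let eT : T ≃ₗ[R] LinearMap.range f := LinearEquiv.ofInjective f hinj
  haveI : IsSimpleModule R (LinearMap.range f) := IsSimpleModule.congr eT.symm
  haveI : Nontrivial T := IsSimpleModule.nontrivial R T
  let g : LinearMap.range f →ₗ[R] N := T.subtype ∘ₗ eT.symm.toLinearMap
  have hg : Function.Injective g := T.injective_subtype.comp eT.symm.injective
  have hg0 : g = 0 := h _ inferInstance g
  obtain ⟨x, hx⟩ := exists_ne (0 : T)
  refine hx (eT.injective (hg ?_))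
  rw [hg0, LinearMap.zero_apply, LinearMap.zero_apply]

/-! ### The cancellation step -/

/-- **Cancellation of a common simple constituent.**  Let `M`, `N` be semisimple with
`χ_M(a) = χ_N(a)` for `a` in a subset `𝒜 ⊆ R`, let `S ⊆ M` be simple and `f : S → N` a
non-zero `R`-linear map.  If semisimple modules `P`, `P'` of dimension `< dim M` with
`χ_P = χ_{P'}` on `𝒜` are always isomorphic (the induction hypothesis), then `M ≃ N`:
`M = S ⊕ Q`, `N = f(S) ⊕ Q'`, `χ_S χ_Q = χ_M = χ_N = χ_{f(S)} χ_{Q'}` with `χ_S = χ_{f(S)}`,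
and `k[X]` is a domain.  (The step "`[E] = [F]` … implique que `E` et `F` sont isomorphes",
VIII p. 186, cor. de la prop. 7, made explicit.) [cite: BourbakiAlgebreVIII2012, VIII § 20 n° 6, Cor. 1 (p. 378)] -/
theorem Module.nonempty_linearEquiv_of_cancel_simple [IsSemisimpleModule R M]
    [IsSemisimpleModule R N] {𝒜 : Set R}
    (h : ∀ a ∈ 𝒜, (DistribSMul.toLinearMap k M a).charpoly =
      (DistribSMul.toLinearMap k N a).charpoly)
    (S : Submodule R M) [IsSimpleModule R S] (f : S →ₗ[R] N) (hf : f ≠ 0)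
    (ih : ∀ (P : Type w) (P' : Type w') [AddCommGroup P] [Module k P] [Module R P]
      [IsScalarTower k R P] [FiniteDimensional k P] [IsSemisimpleModule R P]
      [AddCommGroup P'] [Module k P'] [Module R P'] [IsScalarTower k R P']
      [FiniteDimensional k P'] [IsSemisimpleModule R P'],
      finrank k P < finrank k M →
      (∀ a ∈ 𝒜, (DistribSMul.toLinearMap k P a).charpoly =
        (DistribSMul.toLinearMap k P' a).charpoly) → Nonempty (P ≃ₗ[R] P')) :
    Nonempty (M ≃ₗ[R] N) := by
  have hfinj : Function.Injective f := (LinearMap.injective_or_eq_zero f).resolve_right hf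
  let e₁ : S ≃ₗ[R] LinearMap.range f := LinearEquiv.ofInjective f hfinj
  -- complements (semisimplicity)
  obtain ⟨Q, hQ⟩ := exists_isCompl S
  obtain ⟨Q', hQ'⟩ := exists_isCompl (LinearMap.range f)
  haveI := Module.finiteDimensional_submodule_tower (k := k) S
  haveI := Module.finiteDimensional_submodule_tower (k := k) Q
  haveI := Module.finiteDimensional_submodule_tower (k := k) Q'
  haveI := Module.finiteDimensional_submodule_tower (k := k) (LinearMap.range f)
  -- characteristic polynomials on the complements agree
  have hc : ∀ a ∈ 𝒜, (DistribSMul.toLinearMap k Q a).charpoly =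
      (DistribSMul.toLinearMap k Q' a).charpoly := by
    intro a ha
    have h1 := Module.charpoly_smul_eq_mul_of_isCompl (k := k) S Q hQ a
    have h2 := Module.charpoly_smul_eq_mul_of_isCompl (k := k) (LinearMap.range f) Q' hQ' a
    rw [h a ha, Module.charpoly_smul_eq_of_linearEquiv (k := k) e₁ a] at h1
    exact mul_left_cancel₀ (LinearMap.charpoly_monic _).ne_zero (h1.symm.trans h2)
  -- the dimension drops
  have hdim : finrank k Q < finrank k M := by
    have h1 := Module.finrank_eq_add_of_isCompl_tower (k := k) S Q hQ
    haveI : Nontrivial S := IsSimpleModule.nontrivial R S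
    have h2 : 0 < finrank k S := Module.finrank_pos
    omega
  obtain ⟨e₂⟩ := ih Q Q' hdim hc
  exact ⟨(Submodule.prodEquivOfIsCompl S Q hQ).symm ≪≫ₗ (e₁.prodCongr e₂) ≪≫ₗ
    Submodule.prodEquivOfIsCompl _ Q' hQ'⟩

end Literature.RepresentationTheory.Semisimple
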